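import Summits.BirchSwinnertonDyer.BirchSwinnertonDyer.Theorems.ResidualThetaTransportAtTwoThetaLayerLambdaCongruenceAtTwoSdTorsionOrbitCount
import Literature.NumberTheory.ModularForms.ParabolicCohomologyGamma0Field
import Mathlib.LinearAlgebra.Matrix.GeneralLinearGroup.FinTwo
import HarnessLib

/-!
# Crux Kan⁺ `ThetaLayerLambdaCongruenceAtTwo` (stmt-BirchSwinnertonDyer-20688), SD floor, brick S1 —
# parabolic–elliptic cocycles of `Γ₀(N)` over an arbitrary field, IIIa: Shapiro's lemma over `K`
# (width seat bsd-wall-rtt-p3-w4 g6; `--supports stmt-BirchSwinnertonDyer-20688`; proofs + internal carriers only,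
# no named fact, no `sorry`; BSD is not proved by any of this)

For a field `K` (any characteristic) let `H = parEllCocycles K N` be the space of maps `u : Γ₀(N) → K` which
are additive (`u(γδ) = u(γ) + u(δ)`) and vanish on every PARABOLIC and on every ELLIPTIC element of
`Γ₀(N)` (Mathlib `Matrix.IsParabolic`, `Matrix.IsElliptic`) — the group-theoretic model of
`H¹(X₀(N)(ℂ), K) = Hom(π₁(X₀(N)), K)`, `π₁(X₀(N)) = Γ₀(N)/⟨⟨±1, elliptic, parabolic⟩⟩`. This file and its
sequel `…SdTorsionShapiroCount` (IIIb) prove the characteristic-free Shimura count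

  `6 dim_K H + 3ε₂ + 4ε₃ + 6ε_∞ ≤ 12 + μ`   (`six_mul_finrank_parEllCocycles_le`),

hence `dim_K H ≤ 2 dim_ℂ S₂(Γ₀(N))` (`finrank_parEllCocycles_le_two_mul_finrank`, with the tree's
`12 dim S₂(Γ₀(N)) + 3ε₂ + 4ε₃ + 6ε_∞ = 12 + μ`). The proof is the `ℝ`-proof of
`ModularSymbolsParabolicCohomologyProofs` (Shapiro lift `E_u(g)(x) = u(s(gx)⁻¹ g s(x))` into `K^X`,
`X = SL(2, ℤ)/Γ₀(N)`; the cocycle is determined by `E(S), E(T)`; three linear conditions; counting) with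
TWO CHANGES that make it work in characteristic `2` and `3`:
* `E(-1) = 0` is obtained from `-1 = (-T)·T⁻¹`, a product of two parabolic elements (not from `2u(-1) = 0`);
* the elliptic hypothesis gives the EXTRA linear conditions `E(S)(x) = u(s(x)⁻¹ S s(x)) = 0` at the `S`-fixed
  cosets and `E(ST)(x) = 0` at the `ST`-fixed cosets (`s(x)⁻¹Ss(x)`, `s(x)⁻¹STs(x)` are then elliptic elements
  of `Γ₀(N)`), so `(E(S), E(T))` lies in the refined solution space built from `kerS`, `kerST` of part I,
  whose dimensions part II bounds by orbit counting (`2 dim kerS + ε₂ ≤ μ`, `3 dim kerST + 2ε₃ ≤ 2μ`) in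
  place of the characteristic-`0` trace identities.
Part IV (`…SdTorsionEichlerShimura`) turns the count into the factorisation of every `u ∈ H` through the
period map `γ ↦ {∞, γ∞}` (`periodFunctional N`), i.e. `Λ/ℓΛ ≅ Γ₀(N)ᵃᵇ/⟨±1, ell, par⟩ ⊗ 𝔽_ℓ`.

PRIOR ART IN THE TREE. `Literature.NumberTheory.ModularForms.ParabolicCountK.finrank_parabolicHoms_le`
(`ParabolicCohomologyGamma0Field`) proves `dim_K H¹_P(Γ₀(N), K) ≤ 2 dim S₂` for the PARABOLIC cocycles
WITHOUT elliptic condition, under `2 ≠ 0`, `3 ≠ 0` in `K` (free-product count; there the elliptic condition is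
automatic). The present files remove the restriction on the characteristic — the case `K = 𝔽₂` is the one the
mod-`2` self-duality needs — at the price (necessary in characteristic `2`, `3`) of the elliptic condition;
the elementary lemmas `map_one_of_additive`, `map_inv_of_additive` are reused from that file.

## References
* G. Shimura, *Introduction to the arithmetic theory of automorphic functions* (1971), §8.1–8.2
  (Prop. 8.1, (8.2.24)) [ShimuraIATAF1971].
* G. Wiese, Multiplicities of Galois representations of weight one, ANT 1 (2007), §2–3 [Wiese2007Multiplicities].
* K. S. Brown, *Cohomology of groups* (1982), III.6 (Shapiro's lemma) [Brown1982CohomologyGroups].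
-/

-- justification: the `Summit.BirchSwinnertonDyer.BirchSwinnertonDyer.…` path repeats a component (route-file convention)
set_option linter.dupNamespace false
set_option autoImplicit false

noncomputable section

open scoped MatrixGroups ModularForm

open CongruenceSubgroup Matrix.SpecialLinearGroup ModularGroup

open Literature.NumberTheory.EllipticCurves.ModularForms

namespace Summit.BirchSwinnertonDyer.BirchSwinnertonDyer.Theorems.SdTorsion

namespace ParabolicCountK

open _root_.Module _root_.LinearMap
open Literature.NumberTheory.ModularForms.ParabolicCountK (map_one_of_additive map_inv_of_additive)
open scoped Classical

variable {K : Type*} [Field K] {N : ℕ}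

/-! ### Parabolic and elliptic elements of `SL(2, ℤ)`: `T⁻¹`, `-T`, `S`, `ST` and their conjugates -/

/-- `T` is parabolic. [folklore] -/
theorem isParabolic_T : ((T : SL(2, ℤ)) : Matrix (Fin 2) (Fin 2) ℤ).IsParabolic := by
  simpa using ParabolicCount.isParabolic_T_pow (n := 1) one_ne_zero

/-- `-T` is parabolic. [folklore] -/
theorem isParabolic_neg_T : ((-T : SL(2, ℤ)) : Matrix (Fin 2) (Fin 2) ℤ).IsParabolic := by
  rw [Matrix.SpecialLinearGroup.coe_neg, Matrix.isParabolic_neg_iff]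
  exact isParabolic_T

/-- `T⁻¹` is parabolic. [folklore] -/
theorem isParabolic_T_inv : ((T⁻¹ : SL(2, ℤ)) : Matrix (Fin 2) (Fin 2) ℤ).IsParabolic := by
  rw [coe_T_inv, Matrix.isParabolic_iff_of_upperTriangular (by simp)]
  simp

/-- `S` is elliptic (`tr S = 0`, discriminant `-4`). [folklore] -/
theorem isElliptic_S : ((S : SL(2, ℤ)) : Matrix (Fin 2) (Fin 2) ℤ).IsElliptic := by
  rw [Matrix.IsElliptic, Matrix.discr_fin_two, Matrix.trace_fin_two, Matrix.det_fin_two, coe_S]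
  simp

/-- The matrix of `ST`. [folklore] -/
theorem coe_S_mul_T : ((S * T : SL(2, ℤ)) : Matrix (Fin 2) (Fin 2) ℤ) = !![0, -1; 1, 1] := by
  rw [Matrix.SpecialLinearGroup.coe_mul, coe_S, coe_T]
  ext i j
  fin_cases i <;> fin_cases j <;> simp [Matrix.mul_apply, Fin.sum_univ_two]

/-- `ST` is elliptic (`tr ST = 1`, discriminant `-3`). [folklore] -/
theorem isElliptic_S_mul_T : ((S * T : SL(2, ℤ)) : Matrix (Fin 2) (Fin 2) ℤ).IsElliptic := by
  rw [Matrix.IsElliptic, Matrix.discr_fin_two, Matrix.trace_fin_two, Matrix.det_fin_two, coe_S_mul_T]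
  simp

/-- Conjugates of elliptic elements are elliptic. [folklore] -/
theorem isElliptic_conj {M : SL(2, ℤ)} (hM : (M : Matrix (Fin 2) (Fin 2) ℤ).IsElliptic)
    (A : SL(2, ℤ)) : ((A⁻¹ * M * A : SL(2, ℤ)) : Matrix (Fin 2) (Fin 2) ℤ).IsElliptic := by
  have hinv : ((A⁻¹ : SL(2, ℤ)) : Matrix (Fin 2) (Fin 2) ℤ) = (A : Matrix (Fin 2) (Fin 2) ℤ)⁻¹ := by
    rw [Matrix.inv_def, Matrix.SpecialLinearGroup.det_coe, Ring.inverse_one, one_smul,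
      Matrix.SpecialLinearGroup.coe_inv]
  rw [Matrix.SpecialLinearGroup.coe_mul, Matrix.SpecialLinearGroup.coe_mul, hinv]
  exact (Matrix.isElliptic_conj'_iff (Matrix.SpecialLinearGroup.toGL A)).mpr hM

/-- At an `S`-fixed coset `x` the transfer element `ℓ(S, x) = s(x)⁻¹ S s(x)` is elliptic. [folklore] -/
theorem isElliptic_liftElem_S {x : Gamma0Coset N} (hx : S • x = x) :
    ((ParabolicCount.liftElem S x : SL(2, ℤ)) : Matrix (Fin 2) (Fin 2) ℤ).IsElliptic := by
  rw [ParabolicCount.coe_liftElem, hx]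
  exact isElliptic_conj isElliptic_S _

/-- At an `ST`-fixed coset `x` the transfer element `ℓ(ST, x) = s(x)⁻¹ ST s(x)` is elliptic. [folklore] -/
theorem isElliptic_liftElem_S_mul_T {x : Gamma0Coset N} (hx : (S * T) • x = x) :
    ((ParabolicCount.liftElem (S * T) x : SL(2, ℤ)) : Matrix (Fin 2) (Fin 2) ℤ).IsElliptic := by
  rw [ParabolicCount.coe_liftElem, hx]
  exact isElliptic_conj isElliptic_S_mul_T _

/-! ### The space of parabolic–elliptic cocycles over `K` -/

variable (K N) in
/-- **The parabolic–elliptic cocycles of `Γ₀(N)` with values in the field `K`**: maps `u : Γ₀(N) → K`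
which are additive and vanish on every parabolic and on every elliptic element of `Γ₀(N)` — the
group-theoretic model of `Hom(π₁(X₀(N)(ℂ)), K) = H¹(X₀(N)(ℂ), K)` (over `ℝ` the elliptic condition is
automatic and this is the tree's `parabolicCocycles N`). [folklore] -/
def parEllCocycles : Submodule K (Gamma0 N → K) where
  carrier := {u | (∀ γ δ : Gamma0 N, u (γ * δ) = u γ + u δ) ∧
    (∀ γ : Gamma0 N, ((γ : SL(2, ℤ)) : Matrix (Fin 2) (Fin 2) ℤ).IsParabolic → u γ = 0) ∧
    ∀ γ : Gamma0 N, ((γ : SL(2, ℤ)) : Matrix (Fin 2) (Fin 2) ℤ).IsElliptic → u γ = 0}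
  add_mem' := by
    rintro u v ⟨hu, hup, hue⟩ ⟨hv, hvp, hve⟩
    refine ⟨fun γ δ ↦ ?_, fun γ hγ ↦ ?_, fun γ hγ ↦ ?_⟩
    · simp only [Pi.add_apply, hu, hv]
      abel
    · simp [hup γ hγ, hvp γ hγ]
    · simp [hue γ hγ, hve γ hγ]
  zero_mem' := ⟨fun _ _ ↦ by simp, fun _ _ ↦ rfl, fun _ _ ↦ rfl⟩
  smul_mem' := by
    rintro c u ⟨hu, hup, hue⟩
    refine ⟨fun γ δ ↦ ?_, fun γ hγ ↦ ?_, fun γ hγ ↦ ?_⟩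
    · simp only [Pi.smul_apply, smul_eq_mul, hu, mul_add]
    · simp [hup γ hγ]
    · simp [hue γ hγ]

/-- Membership in `parEllCocycles`. [folklore] -/
theorem mem_parEllCocycles_iff {u : Gamma0 N → K} :
    u ∈ parEllCocycles K N ↔ (∀ γ δ : Gamma0 N, u (γ * δ) = u γ + u δ) ∧
      (∀ γ : Gamma0 N, ((γ : SL(2, ℤ)) : Matrix (Fin 2) (Fin 2) ℤ).IsParabolic → u γ = 0) ∧
      ∀ γ : Gamma0 N, ((γ : SL(2, ℤ)) : Matrix (Fin 2) (Fin 2) ℤ).IsElliptic → u γ = 0 :=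
  Iff.rfl

/-- **`u(-1) = 0` in EVERY characteristic** for an additive `u` killing the parabolic elements:
`-1 = (-T)·T⁻¹` is a product of two parabolic elements of `Γ₀(N)` (over `ℝ` one argues `2u(-1) = u(1) = 0`
instead, which fails in characteristic `2`). [folklore] -/
theorem map_eq_zero_of_coe_eq_neg_one {u : Gamma0 N → K} (hu : ∀ γ δ, u (γ * δ) = u γ + u δ)
    (hpar : ∀ γ : Gamma0 N, ((γ : SL(2, ℤ)) : Matrix (Fin 2) (Fin 2) ℤ).IsParabolic → u γ = 0)
    {γ : Gamma0 N} (hγ : (γ : SL(2, ℤ)) = -1) : u γ = 0 := by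
  have hT : (T : SL(2, ℤ)) ∈ Gamma0 N := by
    rw [Gamma0_mem, coe_T]
    simp
  have hnegT : (-T : SL(2, ℤ)) ∈ Gamma0 N := by
    rw [Gamma0_mem, Matrix.SpecialLinearGroup.coe_neg, coe_T]
    simp
  let p : Gamma0 N := ⟨-T, hnegT⟩
  let q : Gamma0 N := ⟨T⁻¹, inv_mem hT⟩
  have hpq : γ = p * q := Subtype.ext (by simp [p, q, hγ])
  rw [hpq, hu, hpar p isParabolic_neg_T, hpar q isParabolic_T_inv, add_zero]

/-! ### Shapiro's lemma over `K`: cocycles of `SL(2, ℤ)` in `K^X` from additive maps on `Γ₀(N)` -/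

/-- The **Shapiro lift** `E_u(g) = (x ↦ u(s(gx)⁻¹ g s(x))) ∈ K^X` of `u : Γ₀(N) → K` at `g ∈ SL(2, ℤ)`
(transfer elements `ParabolicCount.liftElem` of the `ℝ` file). [folklore] -/
def lift (u : Gamma0 N → K) (g : SL(2, ℤ)) : Gamma0Coset N → K :=
  fun x ↦ u (ParabolicCount.liftElem g x)

omit [Field K] in
/-- Unfolding `lift`. [folklore] -/
@[simp] theorem lift_apply (u : Gamma0 N → K) (g : SL(2, ℤ)) (x : Gamma0Coset N) :
    lift u g x = u (ParabolicCount.liftElem g x) := rfl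

/-- The coboundary `δf(g) = g^* f - f` of `f ∈ K^X`. [folklore] -/
def cobd (f : Gamma0Coset N → K) (g : SL(2, ℤ)) : Gamma0Coset N → K := coperm g f - f

/-- Coboundaries are cocycles: `δf(gh) = h^* δf(g) + δf(h)`. [folklore] -/
theorem cobd_mul (f : Gamma0Coset N → K) (g h : SL(2, ℤ)) :
    cobd f (g * h) = coperm h (cobd f g) + cobd f h := by
  simp only [cobd, coperm_mul, LinearMap.comp_apply, map_sub]
  abel

/-- `δf(1) = 0`. [folklore] -/
theorem cobd_one (f : Gamma0Coset N → K) : cobd f 1 = 0 := by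
  simp [cobd, coperm_one]

/-- `δf(-1) = 0`. [folklore] -/
theorem cobd_neg_one (f : Gamma0Coset N → K) : cobd f (-1) = 0 := by
  simp [cobd, coperm_neg_one]

/-- Coboundaries restrict to zero on `Γ₀(N)`: `δf(γ)(Γ₀(N)) = 0`. [folklore] -/
theorem cobd_apply_coe_one (f : Gamma0Coset N → K) (γ : Gamma0 N) :
    cobd f γ ((1 : SL(2, ℤ)) : Gamma0Coset N) = 0 := by
  simp [cobd, ParabolicCount.smul_coe_one_of_mem γ.2]

/-- A coboundary `δf(g)` vanishes at the cosets fixed by `g`. [folklore] -/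
theorem cobd_apply_eq_zero_of_smul_eq (f : Gamma0Coset N → K) {g : SL(2, ℤ)} {x : Gamma0Coset N}
    (hx : g • x = x) : cobd f g x = 0 := by
  simp [cobd, hx]

/-- The cocycle `E_u + δf`. [folklore] -/
def tot (u : Gamma0 N → K) (f : Gamma0Coset N → K) (g : SL(2, ℤ)) : Gamma0Coset N → K :=
  lift u g + cobd f g

section Additive

variable {u : Gamma0 N → K} (hu : ∀ γ δ, u (γ * δ) = u γ + u δ)
include hu

/-- **The Shapiro lift of an additive map is a cocycle**: `E(gh) = h^* E(g) + E(h)`. [folklore] -/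
theorem lift_mul (g h : SL(2, ℤ)) : lift u (g * h) = coperm h (lift u g) + lift u h := by
  funext x
  simp only [lift_apply, Pi.add_apply, coperm_apply, ParabolicCount.liftElem_mul, hu]

/-- `E(1) = 0`. [folklore] -/
theorem lift_one : lift u 1 = 0 := by
  funext x
  simp [ParabolicCount.liftElem_one, map_one_of_additive hu]

/-- `E(-1) = 0` for an additive `u` killing the parabolic elements (`ℓ(-1, x) = -1 = (-T)T⁻¹`). [folklore] -/
theorem lift_neg_one
    (hpar : ∀ γ : Gamma0 N, ((γ : SL(2, ℤ)) : Matrix (Fin 2) (Fin 2) ℤ).IsParabolic → u γ = 0) :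
    lift u (-1) = 0 := by
  funext x
  exact map_eq_zero_of_coe_eq_neg_one hu hpar (ParabolicCount.coe_liftElem_neg_one x)

/-- **The lift restricts to `u` on `Γ₀(N)`**: `E_u(γ)(Γ₀(N)) = u(s₀⁻¹γs₀) = u(γ)`. [folklore] -/
theorem lift_apply_coe_one (γ : Gamma0 N) : lift u γ ((1 : SL(2, ℤ)) : Gamma0Coset N) = u γ := by
  have h1 : ParabolicCount.liftElem (γ : SL(2, ℤ)) ((1 : SL(2, ℤ)) : Gamma0Coset N) =
      (⟨ParabolicCount.sec ((1 : SL(2, ℤ)) : Gamma0Coset N), ParabolicCount.sec_one_mem⟩ : Gamma0 N)⁻¹ *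
        γ * ⟨ParabolicCount.sec ((1 : SL(2, ℤ)) : Gamma0Coset N), ParabolicCount.sec_one_mem⟩ :=
    Subtype.ext (by simp [ParabolicCount.smul_coe_one_of_mem γ.2])
  rw [lift_apply, h1, hu, hu, map_inv_of_additive hu]
  ring

/-- `(E_u + δf)(gh) = h^*(E_u + δf)(g) + (E_u + δf)(h)`. [folklore] -/
theorem tot_mul (f : Gamma0Coset N → K) (g h : SL(2, ℤ)) :
    tot u f (g * h) = coperm h (tot u f g) + tot u f h := by
  simp only [tot, lift_mul hu, cobd_mul, map_add]
  abel

/-- `(E_u + δf)(1) = 0`. [folklore] -/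
theorem tot_one (f : Gamma0Coset N → K) : tot u f 1 = 0 := by
  simp [tot, lift_one hu, cobd_one]

/-- `(E_u + δf)(-1) = 0`. [folklore] -/
theorem tot_neg_one
    (hpar : ∀ γ : Gamma0 N, ((γ : SL(2, ℤ)) : Matrix (Fin 2) (Fin 2) ℤ).IsParabolic → u γ = 0)
    (f : Gamma0Coset N → K) : tot u f (-1) = 0 := by
  simp [tot, lift_neg_one hu hpar, cobd_neg_one]

/-- `(E_u + δf)(g⁻¹) = -(g⁻¹)^*(E_u + δf)(g)`. [folklore] -/
theorem tot_inv (f : Gamma0Coset N → K) (g : SL(2, ℤ)) :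
    tot u f g⁻¹ = -coperm g⁻¹ (tot u f g) := by
  have h := tot_mul hu f g g⁻¹
  rw [mul_inv_cancel, tot_one hu] at h
  exact eq_neg_of_add_eq_zero_right h.symm

/-- `(E_u + δf)(γ)(Γ₀(N)) = u(γ)` for `γ ∈ Γ₀(N)`. [folklore] -/
theorem tot_apply_coe_one (f : Gamma0Coset N → K) (γ : Gamma0 N) :
    tot u f γ ((1 : SL(2, ℤ)) : Gamma0Coset N) = u γ := by
  simp only [tot, Pi.add_apply, lift_apply_coe_one hu, cobd_apply_coe_one, add_zero]

/-- **A cocycle of `SL(2, ℤ) = ⟨S, T⟩` vanishing at `S` and `T` vanishes.** [folklore] -/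
theorem tot_eq_zero_of_S_T (f : Gamma0Coset N → K) (hS : tot u f S = 0) (hT : tot u f T = 0)
    (g : SL(2, ℤ)) : tot u f g = 0 := by
  have hg : g ∈ Subgroup.closure ({S, T} : Set SL(2, ℤ)) := by
    rw [SpecialLinearGroup.SL2Z_generators]
    exact Subgroup.mem_top g
  induction hg using Subgroup.closure_induction with
  | mem x hx =>
    rcases hx with rfl | rfl
    · exact hS
    · exact hT
  | one => exact tot_one hu f
  | mul x y _ _ hx hy => rw [tot_mul hu, hx, hy, map_zero, add_zero]
  | inv x _ hx => rw [tot_inv hu, hx, map_zero, neg_zero]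

/-- `E_u(Tⁿ)(x) = ∑_{i<n} E_u(T)(Tⁱx)`. [folklore] -/
theorem lift_T_pow_apply (n : ℕ) (x : Gamma0Coset N) :
    lift u (T ^ n) x = ∑ i ∈ Finset.range n, lift u T (T ^ i • x) := by
  induction n generalizing x with
  | zero => rw [pow_zero, lift_one hu]; simp
  | succ n ih =>
    rw [pow_succ, lift_mul hu, Pi.add_apply, coperm_apply, ih, Finset.sum_range_succ', pow_zero,
      one_smul]
    simp_rw [smul_smul, ← pow_succ]

end Additive

/-! ### The parabolic condition (cusp sums of `E_u(T)` vanish) and the elliptic conditions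
(`E_u(S)`, `E_u(ST)` vanish at the fixed cosets) -/

/-- **`E_u(T^w)(x) = u(s(x)⁻¹ T^w s(x)) = 0` for a parabolic–elliptic cocycle `u` when `T^w x = x`, `w ≠ 0`**
(`s(x)⁻¹T^ws(x)` is parabolic). [folklore] -/
theorem lift_T_pow_apply_eq_zero (u : parEllCocycles K N) {w : ℕ} (hw : w ≠ 0)
    {x : Gamma0Coset N} (hx : T ^ w • x = x) : lift (u : Gamma0 N → K) (T ^ w) x = 0 := by
  rw [lift_apply]
  apply (mem_parEllCocycles_iff.mp u.2).2.1
  rw [ParabolicCount.coe_liftElem, hx]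
  exact ParabolicCount.isParabolic_conj (ParabolicCount.isParabolic_T_pow hw) (ParabolicCount.sec x)

variable [NeZero N]

/-- **The cusp sums of `E_u(T)` vanish** for a parabolic–elliptic cocycle `u`: over the orbit of a base point
`x` of width `w`, `∑_{i<w} E_u(T)(Tⁱx) = E_u(T^w)(x) = 0`. [folklore] -/
theorem cuspSum_lift_T (u : parEllCocycles K N) : cuspSum K N (lift (u : Gamma0 N → K) T) = 0 := by
  funext p
  obtain ⟨p, hp⟩ := p
  rw [cuspSum_apply, Pi.zero_apply, sum_orbitFin_eq,
    ← lift_T_pow_apply (mem_parEllCocycles_iff.mp u.2).1 (width N p) p]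
  exact lift_T_pow_apply_eq_zero u (width_pos N p).ne' (T_pow_width_smul N p)

omit [NeZero N] in
/-- **`E_u(S)(x) = u(s(x)⁻¹ S s(x)) = 0` at an `S`-fixed coset** for a parabolic–elliptic cocycle `u`
(`s(x)⁻¹Ss(x) ∈ Γ₀(N)` is elliptic of order `4`). [folklore] -/
theorem lift_S_apply_eq_zero (u : parEllCocycles K N) {x : Gamma0Coset N} (hx : S • x = x) :
    lift (u : Gamma0 N → K) S x = 0 := by
  rw [lift_apply]
  exact (mem_parEllCocycles_iff.mp u.2).2.2 _ (isElliptic_liftElem_S hx)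

omit [NeZero N] in
/-- **`E_u(ST)(x) = 0` at an `ST`-fixed coset** for a parabolic–elliptic cocycle `u` (`s(x)⁻¹STs(x) ∈ Γ₀(N)`
is elliptic of order `6`). [folklore] -/
theorem lift_S_mul_T_apply_eq_zero (u : parEllCocycles K N) {x : Gamma0Coset N}
    (hx : (S * T) • x = x) : lift (u : Gamma0 N → K) (S * T) x = 0 := by
  rw [lift_apply]
  exact (mem_parEllCocycles_iff.mp u.2).2.2 _ (isElliptic_liftElem_S_mul_T hx)

end ParabolicCountK

end Summit.BirchSwinnertonDyer.BirchSwinnertonDyer.Theorems.SdTorsion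

end
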